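import Literature.Barriers.ABC.BakerMethodBoundsStewartYu1991LineProofs
import HarnessLib

/-!
# Cell abc-stewartyu, the κ-DOOR, I: one `p`-adic slot of the Stewart–Yu 1991 line with an
# `n^{κn} · p^σ` input (planner's `OddKappaDoorSpec`, HOME/plan/KAPPA-DOOR-RECIPE.md)

`Summits/ABC/StewartYu/KappaDoorSlot.lean` — cell `abc-stewartyu` (HOME
`run/shared/lean/pub/abc-stewartyu/`, seat p3; tranche 2, milestone M1⁺ of `HOME/plan/DAG.md`;
theorems only, no definition, no named fact).

INPUT at an odd prime `p` (the body of the planner's `AbcStewartYuPlan.PrimePadicBoundAt p K L κ σ τ τ₁`,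
the shape delivered by WP-M + Theorem A + the glue `GluePrincipalToPrime.lean`):
`ord_p(∏ qᵢ^{eᵢ} − 1) ≤ K·Lⁿ·n^{κn}·p^σ·(∏ log qᵢ)·(log max(3, max|eᵢ|))^τ·(log max(3, ∏ qᵢ))^{τ₁}`
for distinct primes `qᵢ ≠ p` and `e ≠ 0` with `∏ qᵢ^{eᵢ} ≠ 1`.

This file turns it into ONE SLOT of the printed Stewart–Yu 1991 line (the tree's
`Literature.Barriers.ABC.log_le_of_padicRoute` [cite: StewartYu1991, (9)–(14)], which is the case
`κ = 1`, `σ = 2`, `τ = τ₁ = 1` in `log log`-form):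

* `finsetBound_of_finBound` — the Finset-indexed form of the input (generators a finite set `S`
  of primes, exponents `e : ℕ → ℤ` with `|e_q| ≤ B`, `B ≥ 3`);
* **`log_le_of_kappaSlot`** — for an ODD member `w` of the triple, coprime to `uv`, with the
  congruences `ord_p w ≤ ord_p(∏_{q ∣ uv} q^{e_q} − 1)` at every `p ∣ w` (the tree's (10)–(12)):
  `log w ≤ K·Lⁿ·n^{κn}·P(w)^σ·(∏_{q ∣ uv} log q)·(log B)^τ·(log G)^{τ₁+1}` by the max-ord device
  (9), where `n = ω(uv)`, `P(w)` is the largest prime factor of `w`, and `G ≥ 4` bounds `rad(w)`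
  and `∏_{q ∣ uv} q`.

Everything is [folklore] book-keeping on the printed line; nothing new is claimed.
-/

noncomputable section

open Finset Real
open Literature.NumberTheory.DiophantineGeometry
open Literature.Barriers.ABC

namespace Summit.ABC.StewartYu

namespace KappaDoor

/-- The `p`-adic input at the prime `p` in the `Fin`-indexed shape of the planner's
`PrimePadicBoundAt p K L κ σ τ τ₁` (restated here as a predicate so that theorems can quantify over
it; it is definitionally the body of that `def`). [folklore] -/
def FinBoundAt (p : ℕ) (K L κ σ : ℝ) (τ τ₁ : ℕ) : Prop :=
  ∀ (n : ℕ) (q : Fin n → ℕ) (e : Fin n → ℤ),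
    (∀ i, (q i).Prime) → Function.Injective q → (∀ i, q i ≠ p) → e ≠ 0 →
    ∏ i, ((q i : ℚ)) ^ e i ≠ 1 →
    (padicValRat p (∏ i, ((q i : ℚ)) ^ e i - 1) : ℝ) ≤
      K * L ^ n * (n : ℝ) ^ (κ * n) * (p : ℝ) ^ σ * (∏ i, Real.log (q i)) *
        Real.log (max 3 ((Finset.univ.sup fun i => (e i).natAbs : ℕ) : ℝ)) ^ τ *
        Real.log (max 3 (∏ i, ((q i : ℕ) : ℝ))) ^ τ₁

/-! ### From the `Fin`-indexed input to a finite set of prime generators -/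

/-- **The Finset form of the input.** For a prime `p`, a finite set `S` of primes not containing
`p`, exponents `e_q` with `|e_q| ≤ B` (`B ≥ 3`) and `∏_{q ∈ S} q^{e_q} ≠ 1`:
`ord_p(∏ q^{e_q} − 1) ≤ K·L^{#S}·#S^{κ#S}·p^σ·(∏_{q∈S} log q)·(log B)^τ·(log max(3, ∏_{q∈S} q))^{τ₁}`.
[folklore] -/
theorem finsetBound_of_finBound {p : ℕ} {K L κ σ : ℝ} {τ τ₁ : ℕ} (hP : FinBoundAt p K L κ σ τ τ₁)
    (hK : 0 ≤ K) (hL : 0 ≤ L) {S : Finset ℕ} (hS : ∀ q ∈ S, q.Prime) (hpS : p ∉ S)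
    (e : ℕ → ℤ) {B : ℝ} (hB3 : 3 ≤ B) (heB : ∀ q ∈ S, (|e q| : ℝ) ≤ B)
    (hne1 : ∏ q ∈ S, (q : ℚ) ^ e q ≠ 1) :
    (padicValRat p (∏ q ∈ S, (q : ℚ) ^ e q - 1) : ℝ) ≤
      K * L ^ S.card * (S.card : ℝ) ^ (κ * S.card) * (p : ℝ) ^ σ * (∏ q ∈ S, Real.log q) *
        Real.log B ^ τ * Real.log (max 3 (∏ q ∈ S, (q : ℝ))) ^ τ₁ := by
  classical
  set n := S.card with hn
  set φ : Fin n ≃ S := S.equivFin.symm with hφ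
  set q : Fin n → ℕ := fun i => (φ i : ℕ) with hqdef
  set e' : Fin n → ℤ := fun i => e (q i) with he'
  have hqS : ∀ i, q i ∈ S := fun i => (φ i).2
  have hqP : ∀ i, (q i).Prime := fun i => hS _ (hqS i)
  have hinj : Function.Injective q := fun i j hij => φ.injective (Subtype.ext hij)
  have hqp : ∀ i, q i ≠ p := fun i h => hpS (h ▸ hqS i)
  -- re-indexing of products over `S`
  have hreidx : ∀ {M : Type} [CommMonoid M] (f : ℕ → M), ∏ i, f (q i) = ∏ x ∈ S, f x := by
    intro M _ f
    rw [← Finset.prod_coe_sort S f]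
    exact Fintype.prod_equiv φ (fun i => f (q i)) (fun x => f x) (fun i => rfl)
  have hprodQ : ∏ i, ((q i : ℚ)) ^ e' i = ∏ x ∈ S, (x : ℚ) ^ e x := hreidx (fun x => (x : ℚ) ^ e x)
  have hprodlog : ∏ i, Real.log (q i) = ∏ x ∈ S, Real.log x := hreidx (fun x => Real.log x)
  have hprodR : ∏ i, ((q i : ℕ) : ℝ) = ∏ x ∈ S, (x : ℝ) := hreidx (fun x => (x : ℝ))
  have hne1' : ∏ i, ((q i : ℚ)) ^ e' i ≠ 1 := by rw [hprodQ]; exact hne1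
  have he0 : e' ≠ 0 := by
    intro h0
    apply hne1'
    simp [h0]
  have key := hP n q e' hqP hinj hqp he0 hne1'
  rw [hprodQ, hprodlog, hprodR] at key
  -- `log max(3, max |e'|) ≤ log B`
  have hsup : ((max 3 ((Finset.univ.sup fun i => (e' i).natAbs : ℕ)) : ℝ)) ≤ B := by
    refine max_le hB3 ?_
    have h1 : ((Finset.univ.sup fun i => (e' i).natAbs : ℕ) : ℝ) ≤ B := by
      rcases Nat.eq_zero_or_pos n with h0 | hpos
      · have : (Finset.univ : Finset (Fin n)) = ∅ := by
          rw [Finset.univ_eq_empty_iff]; rw [h0]; infer_instance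
        rw [this, Finset.sup_empty]; simp; linarith
      · haveI : Nonempty (Fin n) := ⟨⟨0, hpos⟩⟩
        obtain ⟨i, -, hi⟩ := Finset.exists_mem_eq_sup (Finset.univ : Finset (Fin n))
          Finset.univ_nonempty (fun i => (e' i).natAbs)
        rw [hi]
        have h2 := heB (q i) (hqS i)
        have h3 : (((e' i).natAbs : ℕ) : ℝ) = |(e (q i) : ℝ)| := by
          rw [he', Nat.cast_natAbs, Int.cast_abs]
        rw [h3]; exact h2
    exact h1
  have hlogB : Real.log ((max 3 ((Finset.univ.sup fun i => (e' i).natAbs : ℕ)) : ℝ)) ≤ Real.log B :=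
    Real.log_le_log (lt_of_lt_of_le (by norm_num) (le_max_left _ _)) hsup
  have hlog0 : 0 ≤ Real.log ((max 3 ((Finset.univ.sup fun i => (e' i).natAbs : ℕ)) : ℝ)) :=
    Real.log_nonneg ((le_max_left _ _).trans' (by norm_num))
  have hplog0 : 0 ≤ ∏ x ∈ S, Real.log (x : ℝ) :=
    Finset.prod_nonneg fun x hx => Real.log_nonneg (by exact_mod_cast (hS x hx).one_lt.le)
  have hp0 : (0 : ℝ) ≤ (p : ℝ) ^ σ := Real.rpow_nonneg (Nat.cast_nonneg _) _
  have hmax0 : 0 ≤ Real.log (max 3 (∏ x ∈ S, (x : ℝ))) ^ τ₁ :=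
    pow_nonneg (Real.log_nonneg ((le_max_left _ _).trans' (by norm_num))) _
  refine key.trans ?_
  have hA0 : 0 ≤ K * L ^ n * (n : ℝ) ^ (κ * n) * (p : ℝ) ^ σ * ∏ x ∈ S, Real.log (x : ℝ) := by
    have : 0 ≤ (n : ℝ) ^ (κ * n) := Real.rpow_nonneg (Nat.cast_nonneg _) _
    positivity
  exact mul_le_mul_of_nonneg_right
    (mul_le_mul_of_nonneg_left (pow_le_pow_left₀ hlog0 hlogB τ) hA0) hmax0

/-! ### One slot: the max-ord device at the primes of an odd member -/

/-- **One `p`-adic slot of the line with an `n^{κn}·p^σ` input.** Let `w` be ODD, coprime to `uv`,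
with `ord_p w ≤ ord_p(∏_{q ∣ uv} q^{e_q} − 1)` for every `p ∣ w` (the congruences (10)–(12)),
`|e_q| ≤ B` (`B ≥ 3`), `∏ q^{e_q} ≠ 1`; let `G ≥ 4` bound `∏_{q ∣ uv} q` and `rad w`, and `σ ≥ 0`.
Then `log w ≤ K·Lⁿ·n^{κn}·P(w)^σ·(∏_{q ∣ uv} log q)·((log B)^τ·(log G)^{τ₁}·log G)`, `n = ω(uv)`.
[folklore] -/
theorem log_le_of_kappaSlot {K L κ σ : ℝ} {τ τ₁ : ℕ} (hK : 0 ≤ K) (hL : 0 ≤ L) (hσ : 0 ≤ σ)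
    (hP : ∀ p : ℕ, p.Prime → p ≠ 2 → FinBoundAt p K L κ σ τ τ₁)
    {G : ℝ} (hG4 : 4 ≤ G) {B : ℝ} (hB3 : 3 ≤ B)
    {w u v : ℕ} (e : ℕ → ℤ) (hw : w ≠ 0) (hwodd : Odd w) (hwuv : w.Coprime (u * v))
    (hqG : ∏ q ∈ (u * v).primeFactors, (q : ℝ) ≤ G)
    (hwG : ∏ p ∈ w.primeFactors, (p : ℝ) ≤ G)
    (heB : ∀ q ∈ (u * v).primeFactors, (|e q| : ℝ) ≤ B)
    (hne1 : ∏ q ∈ (u * v).primeFactors, (q : ℚ) ^ e q ≠ 1)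
    (hval : ∀ p ∈ w.primeFactors, (w.factorization p : ℝ) ≤
      padicValRat p (∏ q ∈ (u * v).primeFactors, (q : ℚ) ^ e q - 1)) :
    Real.log w ≤ K * L ^ (u * v).primeFactors.card *
      ((u * v).primeFactors.card : ℝ) ^ (κ * (u * v).primeFactors.card) *
      (largestPrimeFactor w : ℝ) ^ σ * (∏ q ∈ (u * v).primeFactors, Real.log q) *
      (Real.log B ^ τ * Real.log G ^ τ₁ * Real.log G) := by
  classical
  set T := (u * v).primeFactors with hT
  set n := T.card with hn
  set PL := ∏ q ∈ T, Real.log (q : ℝ) with hPL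
  set Pw : ℝ := (largestPrimeFactor w : ℝ) with hPw
  set LG := Real.log G with hLG
  have hG1 : (1 : ℝ) ≤ G := by linarith
  have hLG0 : 0 ≤ LG := Real.log_nonneg hG1
  have hlogB0 : 0 ≤ Real.log B := Real.log_nonneg (by linarith)
  have hTprime : ∀ q ∈ T, q.Prime := fun q hq => Nat.prime_of_mem_primeFactors hq
  have hPL0 : 0 ≤ PL := Finset.prod_nonneg fun q hq =>
    Real.log_nonneg (by exact_mod_cast (hTprime q hq).one_lt.le)
  have hnκ : 0 ≤ (n : ℝ) ^ (κ * n) := Real.rpow_nonneg (Nat.cast_nonneg _) _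
  have hPw1 : (1 : ℝ) ≤ Pw := by rw [hPw]; exact_mod_cast one_le_largestPrimeFactor w
  set M : ℝ := K * L ^ n * (n : ℝ) ^ (κ * n) * Pw ^ σ * PL * (Real.log B ^ τ * LG ^ τ₁) with hM
  have hM0 : 0 ≤ M := by
    have : 0 ≤ Pw ^ σ := Real.rpow_nonneg (by linarith) _
    rw [hM]; positivity
  -- the factor `log max(3, ∏_{uv} q) ≤ log G`
  have hmax : Real.log (max 3 (∏ q ∈ T, (q : ℝ))) ≤ LG := by
    refine Real.log_le_log (lt_of_lt_of_le (by norm_num) (le_max_left _ _)) (max_le (by linarith) hqG)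
  have hmax0 : 0 ≤ Real.log (max 3 (∏ q ∈ T, (q : ℝ))) :=
    Real.log_nonneg ((le_max_left _ _).trans' (by norm_num))
  -- every exponent of `w` is at most `M`
  have hbound : ∀ p ∈ w.primeFactors, (w.factorization p : ℝ) ≤ M := by
    intro p hp
    have hpp : p.Prime := Nat.prime_of_mem_primeFactors hp
    have hp2 : p ≠ 2 := by
      rintro rfl
      have h2 : 2 ∣ w := Nat.dvd_of_mem_primeFactors hp
      exact (Nat.not_even_iff_odd.mpr hwodd) (even_iff_two_dvd.mpr h2)
    have hpT : p ∉ T := by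
      intro hpT
      have h1 : p ∣ w := Nat.dvd_of_mem_primeFactors hp
      have h2 : p ∣ u * v := Nat.dvd_of_mem_primeFactors hpT
      have hg : p ∣ Nat.gcd w (u * v) := Nat.dvd_gcd h1 h2
      rw [hwuv.gcd_eq_one, Nat.dvd_one] at hg
      exact hpp.one_lt.ne' hg
    have key := finsetBound_of_finBound (hP p hpp hp2) hK hL hTprime hpT e hB3 heB hne1
    have hpP : (p : ℝ) ^ σ ≤ Pw ^ σ := by
      have : (p : ℝ) ≤ Pw := by rw [hPw]; exact_mod_cast le_largestPrimeFactor_of_mem_primeFactors hp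
      exact Real.rpow_le_rpow (Nat.cast_nonneg _) this hσ
    have hp0 : (0 : ℝ) ≤ (p : ℝ) ^ σ := Real.rpow_nonneg (Nat.cast_nonneg _) _
    calc (w.factorization p : ℝ)
        ≤ padicValRat p (∏ q ∈ T, (q : ℚ) ^ e q - 1) := hval p hp
      _ ≤ K * L ^ n * (n : ℝ) ^ (κ * n) * (p : ℝ) ^ σ * PL * Real.log B ^ τ *
            Real.log (max 3 (∏ q ∈ T, (q : ℝ))) ^ τ₁ := key
      _ ≤ K * L ^ n * (n : ℝ) ^ (κ * n) * Pw ^ σ * PL * Real.log B ^ τ * LG ^ τ₁ := by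
          have h1 : K * L ^ n * (n : ℝ) ^ (κ * n) * (p : ℝ) ^ σ * PL * Real.log B ^ τ ≤
              K * L ^ n * (n : ℝ) ^ (κ * n) * Pw ^ σ * PL * Real.log B ^ τ := by
            have h0 : 0 ≤ K * L ^ n * (n : ℝ) ^ (κ * n) := by positivity
            have := mul_le_mul_of_nonneg_left hpP h0
            exact mul_le_mul_of_nonneg_right (mul_le_mul_of_nonneg_right this hPL0) (by positivity)
          have h2 : Real.log (max 3 (∏ q ∈ T, (q : ℝ))) ^ τ₁ ≤ LG ^ τ₁ := pow_le_pow_left₀ hmax0 hmax τ₁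
          have h3 : 0 ≤ K * L ^ n * (n : ℝ) ^ (κ * n) * Pw ^ σ * PL * Real.log B ^ τ := by
            have : 0 ≤ Pw ^ σ := Real.rpow_nonneg (by linarith) _
            positivity
          exact mul_le_mul h1 h2 (pow_nonneg hmax0 _) h3
      _ = M := by rw [hM]; ring
  -- (9)
  have h9 := log_le_mul_log_prod_primeFactors hw hbound
  have hradw : Real.log (∏ p ∈ w.primeFactors, (p : ℝ)) ≤ LG := by
    rw [hLG]
    apply Real.log_le_log _ hwG
    exact Finset.prod_pos fun q hq => by exact_mod_cast (Nat.prime_of_mem_primeFactors hq).pos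
  calc Real.log w ≤ M * Real.log (∏ p ∈ w.primeFactors, (p : ℝ)) := h9
    _ ≤ M * LG := mul_le_mul_of_nonneg_left hradw hM0
    _ = K * L ^ n * (n : ℝ) ^ (κ * n) * Pw ^ σ * PL * (Real.log B ^ τ * LG ^ τ₁ * LG) := by
        rw [hM]; ring

end KappaDoor

end Summit.ABC.StewartYu

end
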